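import Summits.ResolutionOfSingularities.ResolutionOfSingularities.Theorems.FrobeniusLadderFInjectiveMacaulayficationProp44SliceDimTwoCodim
import Summits.ResolutionOfSingularities.ResolutionOfSingularities.Theorems.MarkedTransferCampaignW46ThreefoldsTauTwoSlice
import Literature.AlgebraicGeometry.Resolution.CurveCentreNearPointDimension
import HarnessLib

/-!
# [CoP1] Prop. 4.4 (`CossartPiltant2008_prop44`, F-71): the local-dimension-two point slice RELATIVE TO AN OPEN (the piece form the
# patching assembly consumes; discharges `stub_dimTwo_comap` of the cell's assembly skeleton)

[L1 W4.5a · crux `FInjectiveMacaulayfication` (stmt-ResolutionOfSingularities-15315); D-0154 (2) RES inputs cell, seat res-inputs-p-8b.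
PROVED, fact-free, definition-free; nothing of the manuscript under adjudication is used.]

`orderReducible_of_finite_dimTwo` (p615789) settles an input ALL of whose bad points are closed points of local dimension `2`. The patching
assembly (`OrderReducible.of_opens_finite`, Piltant 2013 Prop. 5.1; skeleton `candidates/F71_ASSEMBLY_W46_SKELETON_p8b.lean`) needs the
PIECE form: ONE bad closed point `x` of local dimension `2` inside an open `V`, the other bad points lying outside `V`, conclusion
`OrderReducible (J|_V) m`. As in the W4.6 device `TauTwoChainState` (τ ≥ 2 threefold points) the blowing ups are performed on the WHOLE
scheme and the conclusion over `V` is read off at the end (`OrderReducible.comap_opens_of_seq`): blow up `x`; either no near point lies over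
`x` — then every bad point of the transform maps outside `V`, done — or the UNIQUE near point (`IsBlowup.eq_of_isNear_of_isNear_curve`,
res-inputs-p-8a, CP 2008 Lemma 4.3 (4)) is closed (`isClosed_singleton_of_isNear_curve`), again of embedding dimension `2`
(`IsBlowup.isRegularLocalRing_and_spanFinrank_eq_of_isNear_curve`, res-inputs-p-8a) and of STRICTLY SMALLER colength
(`IsBlowup.colength_weakTransform_lt`, Zariski–Samuel App. 5 / Huneke–Swanson 14.3.4); induction on the colength.

* `orderReducible_comap_of_isolated_dimTwo` — the piece form with `spanFinrank 𝔪_x = 2` and finite colength as hypotheses;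
* `orderReducible_comap_of_isolated_coheight_two` — the same with the bookkeeping derived from `V(J)` of codimension `≥ 2` and
  `coheight x = 2` (= the skeleton's `stub_dimTwo_comap`, now PROVED).

`CossartPiltant2008_prop44` itself is NOT proved; resolution in dimension `≥ 4` / positive characteristic is NOT proved. AI-written; AI review is
weaker than expert review.

References: Cossart–Piltant, J. Algebra 320 (2008), Lemma 4.3 (4), Prop. 4.4 (proof, p. 10) [CossartPiltant2008]; Zariski–Samuel II App. 5
Thm. 3 [ZariskiSamuel1960]; O. Piltant, RACSAM 107 (2013) Prop. 5.1 [Piltant2013].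
-/

-- `Summit.<Summit>.<Sub>.Theorems` with `Sub = Summit` (single-conjunct summit, D-0017)
set_option linter.dupNamespace false

noncomputable section

open CategoryTheory AlgebraicGeometry TopologicalSpace IsLocalRing
open Literature.AlgebraicGeometry.Resolution Scheme.IdealSheafData

namespace Summit.ResolutionOfSingularities.ResolutionOfSingularities.Theorems

namespace CP2008Prop44

universe u

/-- A regular system of parameters is an `IsRsopPart` family (`e = 0`). [cite: Matsumura1987, Thm. 14.2] -/
private theorem isRsopPart_of_span_eq_maximalIdeal' {R : Type u} [CommRing R] [IsRegularLocalRing R] {n : ℕ} (c : Fin n → R)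
    (hc : Ideal.span (Set.range c) = maximalIdeal R) (hd : (maximalIdeal R).spanFinrank = n) : IsRsopPart c := by
  refine ⟨inferInstance, 0, Fin.elim0, ?_, ?_⟩
  · have h := (isRegularLocalRing_iff R).mp inferInstance
    rw [hd] at h
    rw [← h]
    norm_num
  · have : Set.range (Fin.elim0 : Fin 0 → R) = ∅ := Set.range_eq_empty _
    rw [this, Set.union_empty, hc]

/-- A regular system of parameters of length `2` at a point of embedding dimension `2`. [folklore] -/
private theorem exists_rsop_two {X : Scheme.{u}} {x : X} [IsRegularLocalRing (X.presheaf.stalk x)]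
    (hd : (maximalIdeal (X.presheaf.stalk x)).spanFinrank = 2) :
    ∃ c : Fin 2 → X.presheaf.stalk x, Ideal.span (Set.range c) = maximalIdeal _ ∧ IsRsopPart c := by
  obtain ⟨c₀, hc₀⟩ := exists_regularSystemOfParameters (R := X.presheaf.stalk x)
  let c : Fin 2 → X.presheaf.stalk x := fun i => c₀ (i.cast hd.symm)
  have hrange : Set.range c = Set.range c₀ := by
    ext a
    constructor
    · rintro ⟨i, rfl⟩; exact ⟨i.cast hd.symm, rfl⟩
    · rintro ⟨i, rfl⟩; exact ⟨i.cast hd, by simp [c]⟩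
  have hc : Ideal.span (Set.range c) = maximalIdeal _ := by rw [hrange, hc₀]
  exact ⟨c, hc, isRsopPart_of_span_eq_maximalIdeal' c hc hd⟩

/-- `a < b ≤ N + 1` in `ℕ∞` gives `a ≤ N`. [folklore] -/
private theorem enat_le_of_lt_of_le_succ' {a b : ℕ∞} {N : ℕ} (h1 : a < b) (h2 : b ≤ (N : ℕ∞) + 1) : a ≤ N := by
  induction b using ENat.recTopCoe with
  | top => exact absurd h2 (by simp)
  | coe k =>
    induction a using ENat.recTopCoe with
    | top => exact absurd h1 (by simp)
    | coe j =>
      have hjk : j < k := by exact_mod_cast h1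
      have hk : k ≤ N + 1 := by exact_mod_cast h2
      exact_mod_cast (by omega : j ≤ N)

set_option maxHeartbeats 800000 in
/-- The induction behind `orderReducible_comap_of_isolated_dimTwo`: stages `Φ : Z → X₀` of a W4.6 sequence for `(J₀, m)` carrying ONE bad
closed point `z` of embedding dimension `2` over `V` (all other points of order `≥ m` map outside `V`), by a bound `N` on the colength at `z`.
[cite: CossartPiltant2008, Prop. 4.4 (proof, p. 10); Lemma 4.3 (4)] -/
private theorem comap_dimTwo_aux (N : ℕ) :
    ∀ {X₀ : Scheme.{u}} [IsLocallyNoetherian X₀] (_hX₀ : Scheme.IsRegular X₀) (J₀ : X₀.IdealSheafData) {m : ℕ} (_hm : 1 ≤ m)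
      (V : X₀.Opens) {Z : Scheme.{u}} [IsIntegral Z] [IsLocallyNoetherian Z] (_hZ : Scheme.IsRegular Z) {Φ : Z ⟶ X₀}
      {JZ : Z.IdealSheafData} (_hseq : CampaignW46.IsPermissibleBlowupSeq J₀ m Φ JZ) (_hle : ∀ w, idealOrder JZ w ≤ m)
      (z : Z) (_hzc : IsClosed ({z} : Set Z)) (_hbad : ∀ w : Z, (m : ℕ∞) ≤ idealOrder JZ w → w = z ∨ Φ w ∉ (V : Set X₀))
      (_hord : idealOrder JZ z = m) (_hdim : (maximalIdeal (Z.presheaf.stalk z)).spanFinrank = 2)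
      (_hlen : Module.length (Z.presheaf.stalk z) (Z.presheaf.stalk z ⧸ stalkIdeal JZ z) ≤ N),
      CampaignW46.OrderReducible (J₀.comap V.ι) m := by
  induction N with
  | zero =>
    intro X₀ _ hX₀ J₀ m hm V Z _ _ hZ Φ JZ hseq hle z hzc hbad hord hdim hlen
    -- impossible: `J_z ⊆ 𝔪_z`, so the colength is positive
    haveI := hZ z
    have hJle : stalkIdeal JZ z ≤ maximalIdeal _ :=
      ((le_idealOrder_iff JZ z m).mp hord.ge).trans (Ideal.pow_le_self (by omega))
    have hnt : Nontrivial (Z.presheaf.stalk z ⧸ stalkIdeal JZ z) :=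
      Ideal.Quotient.nontrivial_iff.mpr (ne_top_of_le_ne_top (maximalIdeal.isMaximal _).ne_top hJle)
    have hpos : 0 < Module.length (Z.presheaf.stalk z) (Z.presheaf.stalk z ⧸ stalkIdeal JZ z) :=
      Module.length_pos_iff.mpr hnt
    exact absurd (lt_of_lt_of_le hpos hlen) (lt_irrefl _)
  | succ N ih =>
    intro X₀ _ hX₀ J₀ m hm V Z _ _ hZ Φ JZ hseq hle z hzc hbad hord hdim hlen
    classical
    set D : Closeds Z := ⟨{z}, hzc⟩ with hDdef
    have hreg : Scheme.IsRegular (vanishingIdeal D).subscheme := CampaignW46.isRegular_subscheme_vanishingIdeal_singleton hzc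
    have hY : ∀ y ∈ (D : Set Z), idealOrder JZ y = m := fun y hy => by
      have hy' : y = z := hy
      rw [hy']; exact hord
    have hDle : ∀ y ∈ (D : Set Z), (m : ℕ∞) ≤ idealOrder JZ y := fun y hy => (hY y hy).ge
    -- `J_Z ≠ 0`, so the blowing up of the point keeps integrality
    have hJne : JZ ≠ ⊥ := by
      intro hJ
      haveI := hZ z
      have hbot : stalkIdeal (⊥ : Z.IdealSheafData) z = ⊥ := by
        obtain ⟨U, hU, hxU, -⟩ :=
          exists_isAffineOpen_mem_and_subset (X := Z) (x := z) (U := ⊤) (Opens.mem_top _)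
        rw [stalkIdeal_eq_map_germ _ ⟨U, hU⟩ hxU, Scheme.IdealSheafData.ideal_bot, Pi.bot_apply, Ideal.map_bot]
      have h2 := (le_idealOrder_iff (⊥ : Z.IdealSheafData) z (m + 1)).mpr (by rw [hbot]; exact bot_le)
      rw [← hJ, hord] at h2
      exact absurd (by exact_mod_cast h2 : m + 1 ≤ m) (by omega)
    have hDne : vanishingIdeal D ≠ ⊥ := vanishingIdeal_ne_bot_of_forall_idealOrder_eq hJne hm hY
    -- blow up the point
    obtain ⟨Z', π, hπ⟩ := exists_isBlowup Z (vanishingIdeal D)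
    have hseq' : CampaignW46.IsPermissibleBlowupSeq J₀ m (π ≫ Φ) (controlledTransform π (vanishingIdeal D) JZ m) :=
      hseq.blowup D π hreg hDle hπ
    haveI : IsLocallyNoetherian Z' := hπ.isLocallyNoetherian
    haveI : IsIntegral Z' := hπ.isIntegral hDne
    have hZ' : Scheme.IsRegular Z' :=
      ((CampaignW46.IsPermissibleBlowupSeq.single D π hreg hDle hπ).isLocallyNoetherian_and_isRegular inferInstance hZ).2
    set J' := controlledTransform π (vanishingIdeal D) JZ m with hJ'def
    have hle' : ∀ w, idealOrder J' w ≤ m := hπ.idealOrder_controlledTransform_le_of_forall hZ hreg hY hle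
    -- bad points of `Z'` off the fibre of `z` map outside `V`
    have hoff : ∀ w : Z', π w ≠ z → (m : ℕ∞) ≤ idealOrder J' w → (π ≫ Φ) w ∉ (V : Set X₀) := by
      intro w hπw hw
      have hw' : π w ∉ ((vanishingIdeal D).support : Set Z) := by
        rw [Scheme.IdealSheafData.coe_support_vanishingIdeal]; exact hπw
      rw [hJ'def, hπ.idealOrder_controlledTransform_of_not_mem JZ m hw'] at hw
      rcases hbad (π w) hw with h | h
      · exact absurd h hπw
      · rwa [Scheme.Hom.comp_apply]
    -- bad points over `z` are near
    have hnear_of : ∀ w : Z', π w = z → (m : ℕ∞) ≤ idealOrder J' w → IsNear π (vanishingIdeal D) JZ m w :=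
      fun w _ hw => isNear_iff.mpr (le_antisymm (hle' w) hw)
    by_cases hex : ∃ w : Z', π w = z ∧ IsNear π (vanishingIdeal D) JZ m w
    · -- the (unique) near point: recurse with a smaller colength
      obtain ⟨w₀, hw₀, hnear⟩ := hex
      haveI : IsRegularLocalRing (Z.presheaf.stalk (π w₀)) := hZ (π w₀)
      haveI : IsRegularLocalRing (Z'.presheaf.stalk w₀) := hZ' w₀
      have hcl : IsClosed ({π w₀} : Set Z) := by rw [hw₀]; exact hzc
      have hDeq : D = ⟨{π w₀}, hcl⟩ := Closeds.ext (by rw [hDdef]; simp [hw₀])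
      have hd : (maximalIdeal (Z.presheaf.stalk (π w₀))).spanFinrank = 2 := by
        rw [CampaignW46.spanFinrank_maximalIdeal_congr hw₀]; exact hdim
      obtain ⟨c, hc, hcr⟩ := exists_rsop_two hd
      have hgen : stalkIdeal (vanishingIdeal D) (π w₀) = maximalIdeal _ := by
        rw [hDeq]; exact stalkIdeal_vanishingIdeal_singleton hcl
      have hcY : Ideal.span (Set.range c) = stalkIdeal (vanishingIdeal D) (π w₀) := by rw [hc, hgen]
      -- uniqueness of the near point (Lemma 4.3 (4)): the new bad locus over `V` is `{w₀}`
      have hbad' : ∀ w : Z', (m : ℕ∞) ≤ idealOrder J' w → w = w₀ ∨ (π ≫ Φ) w ∉ (V : Set X₀) := by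
        intro w hw
        by_cases hπw : π w = z
        · left
          exact hπ.eq_of_isNear_of_isNear_curve hZ hreg hm hY hcr hcY hnear (hnear_of w hπw hw) (hπw.trans hw₀.symm)
        · exact Or.inr (hoff w hπw hw)
      have hcl' : IsClosed ({w₀} : Set Z') := hπ.isClosed_singleton_of_isNear_curve hZ hZ' hreg hm hY hcl hcr hcY hnear
      have hdim' : (maximalIdeal (Z'.presheaf.stalk w₀)).spanFinrank = 2 := by
        rw [(hπ.isRegularLocalRing_and_spanFinrank_eq_of_isNear_curve hZ hreg hm hY hcr hcY hnear).2, hd]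
      have hord' : idealOrder J' w₀ = m := le_antisymm (hle' w₀) (isNear_iff.mp hnear).ge
      have hlenz : Module.length (Z.presheaf.stalk (π w₀)) (Z.presheaf.stalk (π w₀) ⧸ stalkIdeal JZ (π w₀)) ≤ (N : ℕ∞) + 1 := by
        have h := hlen
        rw [← hw₀] at h
        exact_mod_cast h
      have hfinz : IsFiniteLength (Z.presheaf.stalk (π w₀)) (Z.presheaf.stalk (π w₀) ⧸ stalkIdeal JZ (π w₀)) := by
        rw [← Module.length_ne_top_iff]
        exact ne_top_of_le_ne_top (by simp) hlenz
      have hlt := hπ.colength_weakTransform_lt hm hY rfl (isNear_iff.mp hnear) (hZ (π w₀)) hd hgen hfinz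
      have hlen' : Module.length (Z'.presheaf.stalk w₀) (Z'.presheaf.stalk w₀ ⧸ stalkIdeal J' w₀) ≤ N :=
        enat_le_of_lt_of_le_succ' hlt hlenz
      exact ih hX₀ J₀ hm V hZ' hseq' hle' w₀ hcl' hbad' hord' hdim' hlen'
    · -- no near point over `z`: every bad point of `Z'` maps outside `V`
      push Not at hex
      refine CampaignW46.OrderReducible.comap_opens_of_seq hseq' V fun w hw => ?_
      by_cases hπw : π w = z
      · exact absurd (hnear_of w hπw hw) (hex w hπw)
      · exact hoff w hπw hw

/-- **THE LOCAL-DIMENSION-TWO POINT SLICE RELATIVE TO AN OPEN.** `X` regular, integral, locally Noetherian; `J`, `m ≥ 1`, `ord ≤ m` everywhere;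
`V ⊆ X` open and `x ∈ V` a CLOSED point of embedding dimension `2` with `ord_x J = m` and `𝒪_{X,x}/J_x` of finite length, such that every
point of order `≥ m` is `x` or lies outside `V`. Then `(V, J|_V, m)` is order-reducible. [cite: CossartPiltant2008, Prop. 4.4 (proof, p. 10);
Lemma 4.3 (4)] [cite: Piltant2013, Prop. 5.1] -/
theorem orderReducible_comap_of_isolated_dimTwo {X : Scheme.{u}} [IsIntegral X] [IsLocallyNoetherian X] (hX : Scheme.IsRegular X)
    (J : X.IdealSheafData) {m : ℕ} (hm : 1 ≤ m) (hle : ∀ z, idealOrder J z ≤ m) (V : X.Opens) (x : X) (_hxV : x ∈ V)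
    (hcl : IsClosed ({x} : Set X)) (hbad : ∀ z : X, (m : ℕ∞) ≤ idealOrder J z → z = x ∨ z ∉ (V : Set X))
    (hord : idealOrder J x = m) (hdim : (maximalIdeal (X.presheaf.stalk x)).spanFinrank = 2)
    (hfin : IsFiniteLength (X.presheaf.stalk x) (X.presheaf.stalk x ⧸ stalkIdeal J x)) :
    CampaignW46.OrderReducible (J.comap V.ι) m := by
  obtain ⟨N, hN⟩ := ENat.ne_top_iff_exists.mp (Module.length_ne_top_iff.mpr hfin)
  exact comap_dimTwo_aux N hX J hm V hX CampaignW46.IsPermissibleBlowupSeq.nil hle x hcl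
    (fun z hz => (hbad z hz).imp id fun h => by simpa using h) hord hdim (by rw [← hN])

/-- **The same with the bookkeeping derived from the fact's data** (= the assembly skeleton's `stub_dimTwo_comap`, PROVED): `V(J)` of
codimension `≥ 2` and `coheight x = 2` give the embedding dimension (regular stalk) and the finite colength
(`mem_maxPoints_support_of_coheight_eq_two`, p616283). [cite: CossartPiltant2008, Prop. 4.4 (proof, p. 10)] -/
theorem orderReducible_comap_of_isolated_coheight_two {X : Scheme.{u}} [IsIntegral X] [IsLocallyNoetherian X]
    (hX : Scheme.IsRegular X) (J : X.IdealSheafData) {m : ℕ} (hm : 1 ≤ m) (hle : ∀ z, idealOrder J z ≤ m)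
    (hcodim : ∀ z ∈ J.support, 1 < Order.coheight z) (V : X.Opens) (x : X) (hxV : x ∈ V)
    (hcl : IsClosed ({x} : Set X)) (hbad : ∀ z : X, (m : ℕ∞) ≤ idealOrder J z → z = x ∨ z ∉ (V : Set X))
    (hord : idealOrder J x = m) (hcoh : Order.coheight x = 2) :
    CampaignW46.OrderReducible (J.comap V.ι) m := by
  haveI := hX x
  have hsupp : x ∈ (J.support : Set X) := by
    rw [SetLike.mem_coe, ← one_le_idealOrder_iff, hord]
    exact_mod_cast hm
  exact orderReducible_comap_of_isolated_dimTwo hX J hm hle V x hxV hcl hbad hord (spanFinrank_maximalIdeal_stalk_eq x hcoh)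
    (isFiniteLength_quotient_stalkIdeal_of_mem_maxPoints (mem_maxPoints_support_of_coheight_eq_two hcodim hsupp hcoh))

end CP2008Prop44

end Summit.ResolutionOfSingularities.ResolutionOfSingularities.Theorems

end
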